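import Summits.QuantumFields.YangMills.Theorems.BalabanUVNodesPortS1FlatLQt

/-!
# NODE O port PT-A — FE-1 (T1), row (L3-a) of `FIBRE-CHART-LAW-v1` (46338b5b1045e3b8): «`Q̃ = 0`» IS «the average is unchanged» — [I] (2.4) «The expression under the δ-function is equal to
# M(V′V^{(k)})M(V^{(k)})⁻¹ = exp iQ̃(B′)» read at ★★ DEF-1's `recordQt F k K V^{(k)} x c = log(M(pert V^{(k)} x)(c)·M(V^{(k)})(c)⁻¹)` (✓`…K0RecordFormatNamesFluct` :90): inside the series-log
# window `‖M(V′V^{(k)})(c)M(V^{(k)})(c)⁻¹ − 1‖ < 1`, `recordQt … x c = 0 ↔ Ū(pert V^{(k)} x)(c) = Ū(V^{(k)})(c)`; hence on the fibre of a background with `Ū(V^{(k)}) = W` (e.g. the axial representative,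
# ✓`Node00.avg_critCfgAxOfRecord`): `Ū(pert V^{(k)} x) = W ↔ ∀ c, recordQt … x c = 0` — the δ-function of (2.1) in DEF-1's flat coordinates

Cell `ym-nodeO-ideate`, porter seat `ymgap-nodeO-port-PTA-1` (gen 9); `--kind proof --supports stmt-QuantumFields-27930 --as helper` (the P-β pen of `FIBRE-CHART-LAW-v1` §3).  [I] = [Balaban1987RG1].
Tools: ✓`MatrixLog.exp_mlog` (`‖X − 1‖ < 1 ⇒ exp (mlog X) = X`), ✓`MatrixLog.norm_mlog_le_div` (so `mlog 1 = 0`).  The window is DISPLAYED as a hypothesis (it holds at `x = 0` — `recordQt_window_zero` — and the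
quantitative radius in `x` is N07∕N09's central-response content, not restated here).

CONTENT (theorems only; no `def`, no `instance`, no `sorry`): `mlog_one'` (`mlog 1 = 0` in any complete normed algebra), `recordQt_apply` (unfolding), ★ `recordQt_eq_zero_of_avg_eq` (no window needed),
★ `avg_eq_of_recordQt_eq_zero` (window), ★★ `recordQt_eq_zero_iff` (window), `recordQt_window_zero`, `recordQt_zero'` (`Q̃(0) = 0`), ★★ `avg_pert_eq_iff_forall_recordQt_eq_zero` (the fibre of `W := Ū(V^{(k)})`),
★★ `avg_pert_eq_iff_of_avg_eq` (the fibre over `W` through any representative `V^{(k)}` with `Ū(V^{(k)}) = W`).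

HONEST FRAMING.  `exp ∘ log = id` bookkeeping on the tree's typed (0.4)∕(2.4) objects; NOTHING of Bałaban's estimates asserted, ported or discharged; the window radius in `x`, (o1) `D̃`, (o3), (o4), (T2)
NOT here; `stub_P0C` ∕ `stub_FE` OPEN; ⟨27930⟩ ⁸-Ax-LR4 OPEN · no claim; NODE O 0∕1; COUNT 8∕28 · K 1∕4 UNMOVED; finite `𝕋⁴_{L^K}` at fixed ε — NOT continuum ∕ OS ∕ Clay; **the Yang–Mills mass gap
is NOT proved by any of this.**  Standard axioms.
-/

noncomputable section

open scoped Matrix.Norms.L2Operator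

namespace Summit.QuantumFields.YangMills.Theorems.BalabanUVNodesPortS1

open Literature.MathematicalPhysics.QuantumFieldTheory.Balaban1983to89
open Literature.MathematicalPhysics.QuantumFieldTheory.Balaban1983to89.Node00
open Literature.MathematicalPhysics.QuantumFieldTheory.Balaban1983to89.T4Continuum (T4Family)
open Summit.QuantumFields.YangMills.Theorems.K0RecordFormatNames (FluctIdx pert recordQt)
open NormedSpace (exp)

/-- `log 1 = 0` for the series logarithm `MatrixLog.mlog` of any complete normed algebra (from `‖mlog X‖ ≤ ‖X − 1‖∕(1 − ‖X − 1‖)` at `X = 1`). [folklore] -/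
theorem mlog_one' {𝔄 : Type*} [NormedRing 𝔄] [NormedAlgebra ℂ 𝔄] [CompleteSpace 𝔄] [NormOneClass 𝔄] : MatrixLog.mlog (1 : 𝔄) = 0 := by
  have h := MatrixLog.norm_mlog_le_div (X := (1 : 𝔄)) (by rw [sub_self, norm_zero]; exact zero_lt_one)
  rw [sub_self, norm_zero, zero_div] at h
  exact norm_le_zero_iff.1 h

variable (F : T4Family)

/-- Unfolding of DEF-1's `Q̃`: `recordQt F k K Vk x c = mlog ↑(Ū(pert Vk x)(c) · Ū(Vk)(c)⁻¹)`. [cite: Balaban1987RG1, (2.4) p.266, p.267] -/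
theorem recordQt_apply (k K : ℕ) (Vk : GaugeField (F.P K) k (SU 2)) (x : FluctIdx F k K → ℝ) (c : PBond (F.P K) (k + 1)) :
    recordQt F k K Vk x c =
      MatrixLog.mlog ((((avOfRecord F 2 K k).avg (pert F k K Vk x) c * ((avOfRecord F 2 K k).avg Vk c)⁻¹ : SU 2) : MatA 2)) := rfl

/-- ★ **«the average is unchanged» ⇒ `Q̃ = 0`** (no window needed): `Ū(pert Vk x)(c) = Ū(Vk)(c) ⇒ recordQt F k K Vk x c = 0`. [cite: Balaban1987RG1, (2.4) p.266] -/
theorem recordQt_eq_zero_of_avg_eq (k K : ℕ) (Vk : GaugeField (F.P K) k (SU 2)) (x : FluctIdx F k K → ℝ) (c : PBond (F.P K) (k + 1))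
    (h : (avOfRecord F 2 K k).avg (pert F k K Vk x) c = (avOfRecord F 2 K k).avg Vk c) : recordQt F k K Vk x c = 0 := by
  rw [recordQt_apply, h, mul_inv_cancel, OneMemClass.coe_one]
  exact mlog_one'

/-- ★ **`Q̃ = 0` ⇒ «the average is unchanged», inside the series-log window** `‖Ū(pert Vk x)(c)·Ū(Vk)(c)⁻¹ − 1‖ < 1` (`exp ∘ mlog = id` there). [cite: Balaban1987RG1, (2.4) p.266, p.267] -/
theorem avg_eq_of_recordQt_eq_zero (k K : ℕ) (Vk : GaugeField (F.P K) k (SU 2)) (x : FluctIdx F k K → ℝ) (c : PBond (F.P K) (k + 1))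
    (hM : ‖((((avOfRecord F 2 K k).avg (pert F k K Vk x) c * ((avOfRecord F 2 K k).avg Vk c)⁻¹ : SU 2) : MatA 2)) - 1‖ < 1)
    (h : recordQt F k K Vk x c = 0) : (avOfRecord F 2 K k).avg (pert F k K Vk x) c = (avOfRecord F 2 K k).avg Vk c := by
  have hexp := MatrixLog.exp_mlog hM
  rw [← recordQt_apply, h, NormedSpace.exp_zero] at hexp
  have h1 : ((avOfRecord F 2 K k).avg (pert F k K Vk x) c * ((avOfRecord F 2 K k).avg Vk c)⁻¹ : SU 2) = 1 :=
    Subtype.ext (by rw [OneMemClass.coe_one]; exact hexp.symm)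
  exact mul_inv_eq_one.1 h1

/-- ★★ **(2.4) IN DEF-1's COORDINATES**: inside the series-log window, `recordQt F k K Vk x c = 0 ↔ Ū(pert Vk x)(c) = Ū(Vk)(c)`. [cite: Balaban1987RG1, (2.4) p.266, p.267] -/
theorem recordQt_eq_zero_iff (k K : ℕ) (Vk : GaugeField (F.P K) k (SU 2)) (x : FluctIdx F k K → ℝ) (c : PBond (F.P K) (k + 1))
    (hM : ‖((((avOfRecord F 2 K k).avg (pert F k K Vk x) c * ((avOfRecord F 2 K k).avg Vk c)⁻¹ : SU 2) : MatA 2)) - 1‖ < 1) :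
    recordQt F k K Vk x c = 0 ↔ (avOfRecord F 2 K k).avg (pert F k K Vk x) c = (avOfRecord F 2 K k).avg Vk c :=
  ⟨avg_eq_of_recordQt_eq_zero F k K Vk x c hM, recordQt_eq_zero_of_avg_eq F k K Vk x c⟩

/-- The window holds at `x = 0` (`pert Vk 0 = Vk`, the quotient is `1`). [cite: Balaban1987RG1, (2.4) p.266] -/
theorem recordQt_window_zero (k K : ℕ) (Vk : GaugeField (F.P K) k (SU 2)) (c : PBond (F.P K) (k + 1)) :
    ‖((((avOfRecord F 2 K k).avg (pert F k K Vk 0) c * ((avOfRecord F 2 K k).avg Vk c)⁻¹ : SU 2) : MatA 2)) - 1‖ < 1 := by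
  rw [pert_zero, mul_inv_cancel, OneMemClass.coe_one, sub_self, norm_zero]
  exact zero_lt_one

/-- `Q̃(0) = 0`. [cite: Balaban1987RG1, p.267 («D̃(B) has an expansion beginning with quadratic terms»)] -/
theorem recordQt_zero' (k K : ℕ) (Vk : GaugeField (F.P K) k (SU 2)) (c : PBond (F.P K) (k + 1)) : recordQt F k K Vk 0 c = 0 :=
  recordQt_eq_zero_of_avg_eq F k K Vk 0 c (by rw [pert_zero])

/-- ★★ **THE FIBRE OF `Ū(V^{(k)})` IN THE CHART**: inside the window at every coarse bond, `Ū(pert Vk x) = Ū(Vk) ↔ ∀ c, recordQt F k K Vk x c = 0` — the δ-function `δ(V̄W⁻¹)` of (2.1) read as «`Q̃(B′) = 0`».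
[cite: Balaban1987RG1, (2.1) p.265, (2.4) p.266, (2.10) p.267] -/
theorem avg_pert_eq_iff_forall_recordQt_eq_zero (k K : ℕ) (Vk : GaugeField (F.P K) k (SU 2)) (x : FluctIdx F k K → ℝ)
    (hM : ∀ c : PBond (F.P K) (k + 1), ‖((((avOfRecord F 2 K k).avg (pert F k K Vk x) c * ((avOfRecord F 2 K k).avg Vk c)⁻¹ : SU 2) : MatA 2)) - 1‖ < 1) :
    (avOfRecord F 2 K k).avg (pert F k K Vk x) = (avOfRecord F 2 K k).avg Vk ↔ ∀ c, recordQt F k K Vk x c = 0 := by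
  constructor
  · intro h c
    exact recordQt_eq_zero_of_avg_eq F k K Vk x c (by rw [h])
  · intro h
    funext c
    exact avg_eq_of_recordQt_eq_zero F k K Vk x c (hM c) (h c)

/-- ★★ **THE FIBRE OVER `W` THROUGH ANY REPRESENTATIVE** `V^{(k)}` with `Ū(V^{(k)}) = W` (print: the axial representative `V^{(k)}_{ax}(W)`, ✓`Node00.avg_critCfgAxOfRecord`): inside the window,
`Ū(pert V^{(k)} x) = W ↔ ∀ c, recordQt F k K V^{(k)} x c = 0`. [cite: Balaban1987RG1, (2.1)–(2.4) pp.265–266, (2.10) p.267] -/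
theorem avg_pert_eq_iff_of_avg_eq (k K : ℕ) (Vk : GaugeField (F.P K) k (SU 2)) (W : GaugeField (F.P K) (k + 1) (SU 2)) (hW : (avOfRecord F 2 K k).avg Vk = W)
    (x : FluctIdx F k K → ℝ)
    (hM : ∀ c : PBond (F.P K) (k + 1), ‖((((avOfRecord F 2 K k).avg (pert F k K Vk x) c * (W c)⁻¹ : SU 2) : MatA 2)) - 1‖ < 1) :
    (avOfRecord F 2 K k).avg (pert F k K Vk x) = W ↔ ∀ c, recordQt F k K Vk x c = 0 := by
  subst hW
  exact avg_pert_eq_iff_forall_recordQt_eq_zero F k K Vk x hM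

end Summit.QuantumFields.YangMills.Theorems.BalabanUVNodesPortS1

end
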